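import Literature.IUT.HodgeTheaters.StableCurveTemperedDataOfSpecialFibreSec2A3TrichotomyNV
import Literature.IUT.HodgeTheaters.StableCurveTemperedDataOfSpecialFibreSec2OneCallDdOfChart
import Literature.AnabelianGeometry.SemiGraphs.NodNonArithCosetTreeTrichotomy
import HarnessLib

/-!
# NON-VACUITY of the chart-bound binder set of the §2 one-call of record ([IUTchI] Prop. 2.4 (ii), Cor. 2.5):
# `R`, `hVcS_j`, the endpoint data, `hA3_j` and `hI_j^frame` AT `decompositionDataOfChart (R j) ι_j` are JOINTLY INHABITED

S. Mochizuki, *Inter-universal Teichmüller theory I*, kurims manuscript (May 2020), §2, Prop. 2.4 (ii) pp. 50–51 and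
Cor. 2.5 p. 51 [cite: Mochizuki2012, Prop 2.4(ii) pp.50-51] [cite: Mochizuki2012, Cor 2.5 p.51] (D-0012 claim key, status
disputed; nothing of the series is asserted here); S. Mochizuki, *Semi-graphs of anabelioids*, Publ. RIMS **42** (2006),
kurims ms §5 p. 65 (decomposition groups as commensurators; Rmk 5.3.1) and Thm 5.4 (i) p. 66
[cite: MochizukiSemiAnbd2006, §5 p.65] [cite: MochizukiSemiAnbd2006, Rmk 5.3.1, p. 65] [cite: MochizukiSemiAnbd2006, Thm 5.4 (i), p. 66];
[NodNon] Prop 3.9 (i) p. 322 [cite: HoshiMochizukiNodNon2011, Prop 3.9 (i) p.322].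

PROOF-ONLY companion (abc-iut cell, seat abc-iut-L5-t11 gen 16, row R79 «COR25-CLOSER@CHART», abc-iut-L5-lead RULINGS
#144 (1)) of `StableCurveTemperedDataOfSpecialFibreSec2OneCallA3ByNameOfChart.lean`; no definition, no instance, no notation,
no new `Prop` fact.  That file states the §2 one-call with EVERY (ii)-binder at abc-iut-L3's produced decomposition data
`decompositionDataOfChart (R j) ι_j` (DATA `R : ∀ j, ChartRepresentatives (T.chart j)`; FACT-class predicates `hI_j^frame`,
`hVcS_j`, `hA3_j` (abc-iut-L3's `ArithCosetTreeTrichotomy`, p516099); endpoint data + seven side conditions).  The joint NVs of record (p478892 / p497058 / p508121)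
inhabit the DATA/ORIGIN binders and the free-`Dd` trichotomy set, but not `R` / the chart data.  This file:

* § A (generic, namespace `ArithTrichotomyOfChartNV`): `commensurator_eq_top_of_normal`;
  `verticialEdgeLikeCompactAmple_of_forall_vertGp_eq_top` — abc-iut-L3's Rmk 5.3.1 predicate holds for branch-free
  decomposition data with all verticial groups `⊤` in a compact group under an onto augmentation;
  `arithMaximalCompactStatementI_of_forall_vertGp_eq_top` — abc-iut-L3's Thm 5.4 (i) predicate holds for decomposition data
  with a vertex and all verticial groups `⊤`; and (per datum) `isCompact_top_levelQuotient`.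
* § B headline `sec2_oneCall_trichotomy_ofChart_nonvacuous`: at the exposed cusped free-profinite witness
  (`exists_piData_cusp_torsionFreeAb_ab_adm_exposed`: compact `Π^temp_{X_K}`, one-vertex branch-free level graphs,
  `verticialSubgroups = {⊤}`), with `R j` from p504001 § C `chartRepresentatives_nonempty_of_isEmpty_branch` and the EMPTY
  endpoint datum, the produced verticial groups are `arithVertGp (R j) ι_j v = commensurator (ι_j(⊤)) = commensurator N̄_j = ⊤`
  (p504001 `levelChartEmbedding_range`, `N̄_j` normal), whence `hVcS_j`, the side conditions, `hA3_j` (abc-iut-L3's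
  `ArithCosetTreeTrichotomy` AT the produced data — definitionally p508121's `trichotomy_of_subsingleton_of_vertGp_eq_top`
  there) and `hI_j^frame` hold together, and the conclusion
  [IUTchI] Prop. 2.4 (i)(ii)(iii) ∧ Cor. 2.5 holds there (p493381's literal one-vertex call, as in p508121).

HONEST TAGS.  DEGENERATE / WEAK NV: one vertex, no edge, no branch per level — the trichotomy holds by its first disjunct,
the edge-like half of Rmk 5.3.1 and the endpoint side conditions are vacuous; a NON-degenerate instance (a genuine
two-component special fibre with its [NodNon] input) is NOT constructed here.  NV = consistency evidence for OUR displayed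
binders only; inhabited ≠ discharged; typed ≠ proved; nothing here asserts that abc is proved or refuted, and nothing here
bears on [IUTchIII] Cor. 3.12.
-/

noncomputable section

namespace Literature.IUT.HodgeTheaters

open _root_.Topology
open scoped Pointwise
open Literature.AnabelianGeometry.SemiGraphs Literature.AnabelianGeometry.SemiGraphs.ProfiniteSemiGraph

universe uE

/-! ### A. Generic: decomposition data all of whose verticial groups are `⊤` -/

namespace ArithTrichotomyOfChartNV

variable {Gtp : Type*} [Group Gtp] [TopologicalSpace Gtp]
  {PA : Type*} [Group PA] [TopologicalSpace PA] {V B : Type*}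

/-- The commensurator of a NORMAL subgroup is the whole group ("`H, Z_G(H) ⊆ N_G(H) ⊆ C_G(H)`", [SemiAnbd] §0 p. 5,
with `N_G(H) = G`): every `g` conjugates `H` onto itself, which is commensurable with `H`.  (Private twin, kept
build-independent, of abc-iut-L4's `commensurator_eq_top_of_normal` in `AbsTopII/Prop13UniversalClosures.lean`.)
[cite: MochizukiSemiAnbd2006, §0 p.5] -/
theorem commensurator_eq_top_of_normal {G : Type*} [Group G] (H : Subgroup G) [hH : H.Normal] :
    Subgroup.Commensurable.commensurator H = ⊤ := by
  refine top_le_iff.mp fun g _ => ?_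
  rw [Subgroup.Commensurable.commensurator_mem_iff, hH.conjAct]

/-- **The p. 65 commensurator `arithVertGp R ι v` is ALL of `Gtp` when the chosen verticial representative is `⊤` and the
image of `ι` is a normal subgroup** (`commensurator (ι(⊤)) = commensurator (range ι) = ⊤`).  WEAK-NV ingredient (the
one-vertex fibres of the §2 NV models, where `verticialSubgroups = {⊤}` and `range ι_j = N̄_j ⊴ Π^tp_j`).
[cite: MochizukiSemiAnbd2006, §5, p. 65] -/
theorem arithVertGp_eq_top_of_Hv_eq_top {𝒢 : ProfiniteSemiGraph} {c : TemperedPiChart 𝒢} {G' : Type*} [Group G']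
    (R : ChartRepresentatives c) (ι : c.G →* G') (v : 𝒢.graph.Vertex) (hv : R.Hv v = ⊤) (N : Subgroup G') [N.Normal]
    (hr : ι.range = N) : arithVertGp R ι v = ⊤ := by
  rw [arithVertGp, hv, ← MonoidHom.range_eq_map, hr]
  exact commensurator_eq_top_of_normal N

/-- **[SemiAnbd] Rmk 5.3.1 (abc-iut-L3's predicate `VerticialEdgeLikeCompactAmpleStatement`) at `⊤`-verticial,
branch-free decomposition data**: if `Gtp` (playing `Π^temp_𝔊`) has compact underlying space, the augmentation is onto,
every verticial decomposition group is `⊤` and there are no branches, then every verticial subgroup is `⊤` — compact and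
arithmetically ample — and there is no edge-like subgroup.  WEAK-NV ingredient, labelled.
[cite: MochizukiSemiAnbd2006, Rmk 5.3.1, p. 65] -/
theorem verticialEdgeLikeCompactAmple_of_forall_vertGp_eq_top (D : DecompositionData Gtp V B) (aug : Gtp →* PA)
    (hc : IsCompact ((⊤ : Subgroup Gtp) : Set Gtp)) (haug : Function.Surjective aug) (htop : ∀ v, D.vertGp v = ⊤)
    (hB : ∀ b : B, False) : VerticialEdgeLikeCompactAmpleStatement D aug := by
  intro K hK
  rcases hK with ⟨v, g, rfl⟩ | ⟨b, -, -⟩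
  · have hKtop : conjSubgroup g (D.vertGp v) = ⊤ := by
      rw [htop v, conjSubgroup]
      exact Subgroup.map_top_of_surjective _ (MulAut.conj g).surjective
    rw [hKtop]
    refine ⟨hc, ?_⟩
    change IsOpen (((⊤ : Subgroup Gtp).map aug : Subgroup PA) : Set PA)
    rw [Subgroup.map_top_of_surjective aug haug, Subgroup.coe_top]
    exact isOpen_univ
  · exact (hB b).elim

/-- **[SemiAnbd] Thm 5.4 (i) (abc-iut-L3's predicate `ArithMaximalCompactStatementI`) at `⊤`-verticial decomposition
data with a vertex**: every compact arithmetically ample `K` lies in the verticial subgroup `⊤`, and two DISTINCT verticial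
subgroups do not exist (all are `⊤`), so the second clause is vacuous.  WEAK-NV ingredient, labelled.
[cite: MochizukiSemiAnbd2006, Thm 5.4 (i), p. 66] -/
theorem arithMaximalCompactStatementI_of_forall_vertGp_eq_top (D : DecompositionData Gtp V B) (aug : Gtp →* PA)
    (v₀ : V) (htop : ∀ v, D.vertGp v = ⊤) : ArithMaximalCompactStatementI D aug := by
  have hvert : ∀ W : Subgroup Gtp, IsVerticial D W → W = ⊤ := by
    rintro W ⟨v, g, rfl⟩
    rw [htop v, conjSubgroup]
    exact Subgroup.map_top_of_surjective _ (MulAut.conj g).surjective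
  intro K _ _
  refine ⟨⟨⊤, ⟨v₀, 1, ?_⟩, le_top⟩, fun W₁ W₂ hW₁ hW₂ hne _ _ => ?_⟩
  · rw [htop v₀, conjSubgroup]
    exact (Subgroup.map_top_of_surjective _ (MulAut.conj (1 : Gtp)).surjective).symm
  · exact absurd ((hvert W₁ hW₁).trans (hvert W₂ hW₂).symm) hne

end ArithTrichotomyOfChartNV

namespace StableCurveTemperedData

namespace OfSpecialFibre

variable {p : ℕ} [Fact p.Prime] (X : TemperedCurve p)

section PerDatum

variable (d : X.GroupLevelData) (T : SpecialFibreTower X.DeltaTemp)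
  (Sigma SigmaHat : Set ℕ) (hsub : Sigma ⊆ SigmaHat) (hne : Set.Nonempty Sigma)
  (hprime : ∀ q ∈ SigmaHat, q.Prime)
  (S : SpecialFibreData (X.toTemperedArithmeticGroup d)) (h36 : S.Gc.Prop36Hypotheses)
  (hp : p ∉ Sigma) (TpH : Subgroup S.chart.G)
  (HatH : Subgroup (TemperedGraphGroupData.exists_completion_of_prop36 S.Gc h36 S.chart).choose)
  (hle : TpH.map (TemperedGraphGroupData.exists_completion_of_prop36 S.Gc h36
    S.chart).choose_spec.choose.toMonoidHom ≤ HatH)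
  (cuspMeetsH : {x : X.Pt // X.IsCusp x} → Prop)
  (P : SpecialFibreTower.PiData X d S T)

/-- **The level quotient `Π^tp_j = Π^temp_{X_K} ⧸ admKer_j` is compact when `Π^temp_{X_K}` is** (the compactness half of
[SemiAnbd] Rmk 5.3.1 at `⊤`-verticial data; cf. p508121 `isCompact_vertGp_of_vertGp_eq_top`).  WEAK-NV ingredient.
[cite: MochizukiSemiAnbd2006, Rmk 5.3.1, p. 65] [claim: Mochizuki2012, status: disputed] -/
theorem isCompact_top_levelQuotient [CompactSpace X.PiTemp] (j : ℕ) :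
    IsCompact ((⊤ : Subgroup ((qTowerOfSpecialFibreTower X T d S h36 Sigma SigmaHat hsub hne hprime hp TpH HatH hle cuspMeetsH P.admKer_normal_pi).Q j).Tp) : Set ((qTowerOfSpecialFibreTower X T d S h36 Sigma SigmaHat hsub hne hprime hp TpH HatH hle cuspMeetsH P.admKer_normal_pi).Q j).Tp) := by
  haveI : (admKerPi X T j).Normal := P.admKer_normal_pi j
  haveI : CompactSpace ((qTowerOfSpecialFibreTower X T d S h36 Sigma SigmaHat hsub hne hprime hp TpH HatH hle cuspMeetsH P.admKer_normal_pi).Q j).Tp := by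
    change CompactSpace (X.PiTemp ⧸ admKerPi X T j)
    infer_instance
  rw [Subgroup.coe_top]
  exact isCompact_univ

end PerDatum

/-! ### B. Headline: the chart-bound binder set inhabited at one explicit datum, and the conclusion there -/

/-- **NON-VACUITY of the chart-bound binder set of `StableCurveTemperedDataOfSpecialFibreSec2OneCallA3ByNameOfChart.lean`
(abc-iut-L5-lead TOKEN STANDARD (b), RULINGS #144 (1) «does the NV cover `R` / the chart data too?»).**  For every prime `p`
there are an EXPLICIT genuine 𝔛-datum (abc-iut-f-193 / abc-iut-L3's cusped free-profinite model «[model: Π^temp = G_{ℚ_p} ×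
F̂₂, one-vertex branch-free fibres, admissible kernels `1`]», through p478892's exposed form) with `P : PiData` and a cusp,
a compatible choice `R` of §3 representatives at every level (p504001 § C: no branches; `verticialSubgroups = {⊤}` there, so
`(R j).Hv v = ⊤`) and the EMPTY endpoint datum, such that — at abc-iut-L3's PRODUCED data `decompositionDataOfChart (R j) ι_j`,
whose verticial groups are `commensurator (range ι_j) = commensurator N̄_j = ⊤` (`N̄_j ⊴ Π^tp_j`, p504001
`levelChartEmbedding_range`) — ALL the (ii)-binders of the one-call of record hold TOGETHER: `hVcS_j` ([SemiAnbd] Rmk 5.3.1,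
abc-iut-L3's predicate: verticial = `⊤`, compact since `Π^temp_{X_K}` is, ample since `πA_j` is onto; no edge-like), the seven
endpoint side conditions (vacuous over `Empty` / no branches), `hA3_j` (abc-iut-L3's `ArithCosetTreeTrichotomy` at the
produced data; definitionally p508121's `trichotomy_of_subsingleton_of_vertGp_eq_top` there: FIRST disjunct), `hI_j^frame` ([SemiAnbd] Thm 5.4 (i), abc-iut-L3's predicate: all verticial `= ⊤`),
AND [IUTchI] Prop. 2.4 (i)(ii)(iii) ∧ Cor. 2.5 hold at that datum (p493381's one-vertex literal call at the canonical frame,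
as in p508121).  The other displayed binders (`hTF`/`hab`/`hadm`, (x)/(x′), cusp, (i)-side PSC data) are inhabited at the
same witness family by p478892 / p497058 / p496462 § C / p479269.  DEGENERATE / WEAK NV, LABELLED (one vertex, no edge, no
branch: the adjacency clauses, the edge-like half of Rmk 5.3.1 and the endpoint side conditions are not exercised); NV =
consistency evidence for OUR binders only; inhabited ≠ discharged.
[cite: Mochizuki2012, Prop 2.4(ii) pp.50-51] [cite: Mochizuki2012, Cor 2.5 p.51] [cite: MochizukiSemiAnbd2006, §5 p.65] [claim: Mochizuki2012, status: disputed] -/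
theorem sec2_oneCall_trichotomy_ofChart_nonvacuous (p : ℕ) [Fact p.Prime] :
    ∃ (X : TemperedCurve p) (d : X.GroupLevelData) (S : SpecialFibreData (X.toTemperedArithmeticGroup d))
      (T : SpecialFibreTower X.DeltaTemp) (P : SpecialFibreTower.PiData X d S T) (_ : {x : X.Pt // X.IsCusp x})
      (Sigma : Set ℕ) (hne : Sigma.Nonempty) (hprime : ∀ q ∈ Sigma, q.Prime) (hp : p ∉ Sigma),
      (∃ (R : ∀ j, ChartRepresentatives (T.chart j))
          (β₁A β₂A : ∀ j : ℕ, Empty → (T.Gc j).graph.Branch) (srcA tgtA : ∀ j : ℕ, Empty → (T.Gc j).graph.Vertex)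
          (c₁A c₂A : ∀ j : ℕ, Empty → ((qTowerOfSpecialFibreTower X T d S S.hyp.toProp36Hypotheses Sigma Sigma Set.Subset.rfl hne hprime hp ⊤ ⊤ le_top (fun _ => True) P.admKer_normal_pi).Q j).Tp),
        (∀ j, haveI := qTower_map_N_normal X d T Sigma Sigma Set.Subset.rfl hne hprime S S.hyp.toProp36Hypotheses hp ⊤ ⊤ le_top (fun _ => True) P j;
    VerticialEdgeLikeCompactAmpleStatement
      (decompositionDataOfChart (R j) ((T.adm j).toMonoidHom.liftOfSurjective (T.adm_surjective j)
          ⟨(((qTowerOfSpecialFibreTower X T d S S.hyp.toProp36Hypotheses Sigma Sigma Set.Subset.rfl hne hprime hp ⊤ ⊤ le_top (fun _ => True) P.admKer_normal_pi).qtp j).comp X.DeltaTemp.subtype).comp (T.N j).subtype,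
            ker_adm_le_ker_levelIncl X d T Sigma Sigma Set.Subset.rfl hne hprime S S.hyp.toProp36Hypotheses hp ⊤ ⊤ le_top (fun _ => True) P j⟩))
      (QuotientGroup.mk' (((T.N j).map X.DeltaTemp.subtype).map ((qTowerOfSpecialFibreTower X T d S S.hyp.toProp36Hypotheses Sigma Sigma Set.Subset.rfl hne hprime hp ⊤ ⊤ le_top (fun _ => True) P.admKer_normal_pi).qtp j)))) ∧
        (∀ j e, (T.Gc j).graph.edgeOf (β₁A j e) = (T.Gc j).graph.edgeOf (β₂A j e)) ∧ (∀ j e, β₁A j e ≠ β₂A j e) ∧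
        (∀ j e, (T.Gc j).graph.abuts (β₁A j e) = some (srcA j e)) ∧
        (∀ j e, (T.Gc j).graph.abuts (β₂A j e) = some (tgtA j e)) ∧
        (∀ j e, MulAut.conj (c₁A j e) • (arithBrGp (R j) ((T.adm j).toMonoidHom.liftOfSurjective (T.adm_surjective j)
          ⟨(((qTowerOfSpecialFibreTower X T d S S.hyp.toProp36Hypotheses Sigma Sigma Set.Subset.rfl hne hprime hp ⊤ ⊤ le_top (fun _ => True) P.admKer_normal_pi).qtp j).comp X.DeltaTemp.subtype).comp (T.N j).subtype,
            ker_adm_le_ker_levelIncl X d T Sigma Sigma Set.Subset.rfl hne hprime S S.hyp.toProp36Hypotheses hp ⊤ ⊤ le_top (fun _ => True) P j⟩) (β₁A j e)) =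
    MulAut.conj (c₂A j e) • (arithBrGp (R j) ((T.adm j).toMonoidHom.liftOfSurjective (T.adm_surjective j)
          ⟨(((qTowerOfSpecialFibreTower X T d S S.hyp.toProp36Hypotheses Sigma Sigma Set.Subset.rfl hne hprime hp ⊤ ⊤ le_top (fun _ => True) P.admKer_normal_pi).qtp j).comp X.DeltaTemp.subtype).comp (T.N j).subtype,
            ker_adm_le_ker_levelIncl X d T Sigma Sigma Set.Subset.rfl hne hprime S S.hyp.toProp36Hypotheses hp ⊤ ⊤ le_top (fun _ => True) P j⟩) (β₂A j e))) ∧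
        (∀ j e, srcA j e = tgtA j e → (c₁A j e)⁻¹ * c₂A j e ∉ (arithVertGp (R j) ((T.adm j).toMonoidHom.liftOfSurjective (T.adm_surjective j)
          ⟨(((qTowerOfSpecialFibreTower X T d S S.hyp.toProp36Hypotheses Sigma Sigma Set.Subset.rfl hne hprime hp ⊤ ⊤ le_top (fun _ => True) P.admKer_normal_pi).qtp j).comp X.DeltaTemp.subtype).comp (T.N j).subtype,
            ker_adm_le_ker_levelIncl X d T Sigma Sigma Set.Subset.rfl hne hprime S S.hyp.toProp36Hypotheses hp ⊤ ⊤ le_top (fun _ => True) P j⟩) (srcA j e))) ∧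
        (∀ (j : ℕ) (b b' : (T.Gc j).graph.Branch) (v w : (T.Gc j).graph.Vertex), (T.Gc j).graph.edgeOf b = (T.Gc j).graph.edgeOf b' → b ≠ b' →
    (T.Gc j).graph.abuts b = some v → (T.Gc j).graph.abuts b' = some w →
      ∃ e, (β₁A j e = b ∧ β₂A j e = b') ∨ (β₁A j e = b' ∧ β₂A j e = b)) ∧
        (∀ j, DecompositionData.ArithCosetTreeTrichotomy.{uE}
      (decompositionDataOfChart (R j) ((T.adm j).toMonoidHom.liftOfSurjective (T.adm_surjective j)
          ⟨(((qTowerOfSpecialFibreTower X T d S S.hyp.toProp36Hypotheses Sigma Sigma Set.Subset.rfl hne hprime hp ⊤ ⊤ le_top (fun _ => True) P.admKer_normal_pi).qtp j).comp X.DeltaTemp.subtype).comp (T.N j).subtype,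
            ker_adm_le_ker_levelIncl X d T Sigma Sigma Set.Subset.rfl hne hprime S S.hyp.toProp36Hypotheses hp ⊤ ⊤ le_top (fun _ => True) P j⟩))
      ((qTowerOfSpecialFibreTower X T d S S.hyp.toProp36Hypotheses Sigma Sigma Set.Subset.rfl hne hprime hp ⊤ ⊤ le_top (fun _ => True) P.admKer_normal_pi).Q j).ι (((qTowerOfSpecialFibreTower X T d S S.hyp.toProp36Hypotheses Sigma Sigma Set.Subset.rfl hne hprime hp ⊤ ⊤ le_top (fun _ => True) P.admKer_normal_pi).qhat j).comp X.toHat.toMonoidHom) X.augGK.toMonoidHom) ∧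
        (∀ j, haveI := qTower_map_N_normal X d T Sigma Sigma Set.Subset.rfl hne hprime S S.hyp.toProp36Hypotheses hp ⊤ ⊤ le_top (fun _ => True) P j;
      ArithMaximalCompactStatementI
        (decompositionDataOfChart (R j) ((T.adm j).toMonoidHom.liftOfSurjective (T.adm_surjective j)
          ⟨(((qTowerOfSpecialFibreTower X T d S S.hyp.toProp36Hypotheses Sigma Sigma Set.Subset.rfl hne hprime hp ⊤ ⊤ le_top (fun _ => True) P.admKer_normal_pi).qtp j).comp X.DeltaTemp.subtype).comp (T.N j).subtype,
            ker_adm_le_ker_levelIncl X d T Sigma Sigma Set.Subset.rfl hne hprime S S.hyp.toProp36Hypotheses hp ⊤ ⊤ le_top (fun _ => True) P j⟩))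
        (QuotientGroup.mk' (((T.N j).map X.DeltaTemp.subtype).map ((qTowerOfSpecialFibreTower X T d S S.hyp.toProp36Hypotheses Sigma Sigma Set.Subset.rfl hne hprime hp ⊤ ⊤ le_top (fun _ => True) P.admKer_normal_pi).qtp j))))) ∧
      (((ofSpecialFibre X d S S.hyp.toProp36Hypotheses Sigma Sigma Set.Subset.rfl hne hprime hp ⊤ ⊤ le_top
            (fun _ => True)).Prop24i ∧
        (ofSpecialFibre X d S S.hyp.toProp36Hypotheses Sigma Sigma Set.Subset.rfl hne hprime hp ⊤ ⊤ le_top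
            (fun _ => True)).Prop24ii ∧
        (ofSpecialFibre X d S S.hyp.toProp36Hypotheses Sigma Sigma Set.Subset.rfl hne hprime hp ⊤ ⊤ le_top
            (fun _ => True)).Prop24iii) ∧
      ((ofSpecialFibre X d S S.hyp.toProp36Hypotheses Sigma Sigma Set.Subset.rfl hne hprime hp ⊤ ⊤ le_top
            (fun _ => True)).Cor25Decomposition ∧
        (ofSpecialFibre X d S S.hyp.toProp36Hypotheses Sigma Sigma Set.Subset.rfl hne hprime hp ⊤ ⊤ le_top
            (fun _ => True)).Cor25Inertia)) := by
  -- (`have` + `rcases`, not `obtain … := term`: generalising the term over this goal is expensive)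
  have hw := exists_piData_cusp_torsionFreeAb_ab_adm_exposed p
  rcases hw with ⟨X, d, S, T, ⟨P⟩, -, -, ⟨x⟩, -, hTF, hab, hadm, hcpt, hUV, -, hB, htop, hVeq⟩
  haveI := hcpt
  -- a prime `q ≠ p`: `Σ := {q}`
  let q : ℕ := if p = 2 then 3 else 2
  have hq : q.Prime := by
    by_cases h : p = 2
    · simp only [q, h, if_true]; exact Nat.prime_three
    · simp only [q, h, if_false]; exact Nat.prime_two
  have hpq : p ≠ q := by
    by_cases h : p = 2
    · simp only [q, h, if_true]; decide
    · simp only [q, h, if_false]; exact h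
  have hprime : ∀ r ∈ ({q} : Set ℕ), r.Prime := fun r hr => by rw [Set.mem_singleton_iff.mp hr]; exact hq
  have hp : p ∉ ({q} : Set ℕ) := fun h => hpq (Set.mem_singleton_iff.mp h)
  haveI hN := fun j => qTower_map_N_normal X d T {q} {q} Set.Subset.rfl (Set.singleton_nonempty q) hprime S S.hyp.toProp36Hypotheses hp ⊤ ⊤ le_top (fun _ => True) P j
  -- the DATA binder `R` (p504001 § C: no branches) and the produced verticial groups `= ⊤`
  let R : ∀ j, ChartRepresentatives (T.chart j) := fun j =>
    haveI := hB j
    (chartRepresentatives_nonempty_of_isEmpty_branch X T j).some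
  have hHv : ∀ j v, (R j).Hv v = ⊤ := fun j v => by
    have hmem := (R j).Hv_mem v
    rw [hVeq j v] at hmem
    exact Set.mem_singleton_iff.mp hmem
  have htopD : ∀ (j : ℕ) (v : (T.Gc j).graph.Vertex), arithVertGp (R j)   ((T.adm j).toMonoidHom.liftOfSurjective (T.adm_surjective j)
            ⟨(((qTowerOfSpecialFibreTower X T d S S.hyp.toProp36Hypotheses {q} {q} Set.Subset.rfl (Set.singleton_nonempty q) hprime hp ⊤ ⊤ le_top (fun _ => True) P.admKer_normal_pi).qtp j).comp X.DeltaTemp.subtype).comp (T.N j).subtype,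
              ker_adm_le_ker_levelIncl X d T {q} {q} Set.Subset.rfl (Set.singleton_nonempty q) hprime S S.hyp.toProp36Hypotheses hp ⊤ ⊤ le_top (fun _ => True) P j⟩) v = ⊤ := fun j v =>
    ArithTrichotomyOfChartNV.arithVertGp_eq_top_of_Hv_eq_top (R j) _ v (hHv j v) _
      (levelChartEmbedding_range X d T {q} {q} Set.Subset.rfl (Set.singleton_nonempty q) hprime S
        S.hyp.toProp36Hypotheses hp ⊤ ⊤ le_top (fun _ => True) P j)
  refine ⟨X, d, S, T, P, x, {q}, Set.singleton_nonempty q, hprime, hp, ?_, ?_⟩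
  · -- (1) the chart-bound binder set, EMPTY endpoint datum
    refine ⟨R, fun _ e => e.elim, fun _ e => e.elim, fun _ e => e.elim, fun _ e => e.elim, fun _ e => e.elim,
      fun _ e => e.elim, fun j => ?_, fun _ e => e.elim, fun _ e => e.elim, fun _ e => e.elim, fun _ e => e.elim,
      fun _ e => e.elim, fun _ e => e.elim, fun j b => (hB j).elim b, ?_, fun j => ?_⟩
    · -- `hVcS_j`: verticial = conjugates of `⊤` = `⊤` (compact: `Π^tp_j` is compact; ample: `πA_j` is onto); no branches
      exact ArithTrichotomyOfChartNV.verticialEdgeLikeCompactAmple_of_forall_vertGp_eq_top _ _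
        (isCompact_top_levelQuotient X d T {q} {q} Set.Subset.rfl (Set.singleton_nonempty q) hprime S
          S.hyp.toProp36Hypotheses hp ⊤ ⊤ le_top (fun _ => True) P j)
        (QuotientGroup.mk'_surjective _) (htopD j) (fun b => (hB j).elim b)
    · -- `hA3_j` = abc-iut-L3's `ArithCosetTreeTrichotomy` AT the produced data: it unfolds (definitionally, p517444's
      -- bridge read backwards) to p506978's shape, which holds by its FIRST disjunct (p508121), one vertex, groups `⊤`
      exact fun j => trichotomy_of_subsingleton_of_vertGp_eq_top X d T {q} {q} Set.Subset.rfl (Set.singleton_nonempty q)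
        hprime S S.hyp.toProp36Hypotheses hp ⊤ ⊤ le_top (fun _ => True) P
        (fun j =>   (decompositionDataOfChart (R j) ((T.adm j).toMonoidHom.liftOfSurjective (T.adm_surjective j)
            ⟨(((qTowerOfSpecialFibreTower X T d S S.hyp.toProp36Hypotheses {q} {q} Set.Subset.rfl (Set.singleton_nonempty q) hprime hp ⊤ ⊤ le_top (fun _ => True) P.admKer_normal_pi).qtp j).comp X.DeltaTemp.subtype).comp (T.N j).subtype,
              ker_adm_le_ker_levelIncl X d T {q} {q} Set.Subset.rfl (Set.singleton_nonempty q) hprime S S.hyp.toProp36Hypotheses hp ⊤ ⊤ le_top (fun _ => True) P j⟩)))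
        (fun j => @Unique.instSubsingleton _ (hUV j).some) htopD j
    · -- `hI_j^frame` at the produced data: every verticial subgroup is `⊤`
      exact ArithTrichotomyOfChartNV.arithMaximalCompactStatementI_of_forall_vertGp_eq_top _ _ (hUV j).some.default
        (htopD j)
  · -- (2) the conclusion at the datum: p493381's one-vertex LITERAL call at the canonical frame (as in p508121)
    exact prop24_cor25_ofPiData_byName_literal_of_oneVertexFibres X T {q} {q} Set.Subset.rfl
      (Set.singleton_nonempty q) hprime d S S.hyp.toProp36Hypotheses hp ⊤ ⊤ le_top (fun _ => True) P x hUV htop hTF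
      (hab {q}) hadm
      (PA := fun j => (((qTowerOfSpecialFibreTower X T d S S.hyp.toProp36Hypotheses {q} {q} Set.Subset.rfl (Set.singleton_nonempty q) hprime hp ⊤ ⊤ le_top (fun _ => True) P.admKer_normal_pi).Q j).Tp ⧸
        ((T.N j).map X.DeltaTemp.subtype).map ((qTowerOfSpecialFibreTower X T d S S.hyp.toProp36Hypotheses {q} {q} Set.Subset.rfl (Set.singleton_nonempty q) hprime hp ⊤ ⊤ le_top (fun _ => True) P.admKer_normal_pi).qtp j)))
      (fun j => QuotientGroup.mk' _)
      (fun j => isOpenMap_frame X d T {q} {q} Set.Subset.rfl (Set.singleton_nonempty q) hprime S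
        S.hyp.toProp36Hypotheses hp ⊤ ⊤ le_top (fun _ => True) P j)
      (fun j n hn => frame_apply_eq_one X d T {q} {q} Set.Subset.rfl (Set.singleton_nonempty q) hprime S
        S.hyp.toProp36Hypotheses hp ⊤ ⊤ le_top (fun _ => True) P j n hn)

end OfSpecialFibre

end StableCurveTemperedData

end Literature.IUT.HodgeTheaters

end
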